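import Summits.ResolutionOfSingularities.ResolutionOfSingularities.Theorems.FrobeniusLadderFRationalResolutionSuspensionBookkeeping
import Mathlib.RingTheory.MvPolynomial.Ideal
import HarnessLib

/-!
# Suspension calibration, Claim B: transfer of the symbolic-square condition along `y, z ↦ 0`

Stub `stub_sq_transfer_constantCoeff` (worker V2) of the skeleton `Sketch` for crux
stmt-ResolutionOfSingularities-15317 (`FrobeniusLadder.FRationalResolution`), continuation seat c2,
wave 3: "the singular locus of the suspension `Σf = {yz + f = 0} ⊂ Spec A[y,z]` is exactly
`Sing V(f) × {y = z = 0}`". Via the criterion "a hypersurface in a regular ambient is regular at `P`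
iff its equation is not in the symbolic square `P⁽²⁾`" (the neighbouring stub), the local comparison
at a prime `P ∋ y, z` of `A[y,z]` reduces to the present elementwise transfer statement.

Write `A[y,z] = MvPolynomial (Fin 2) A` (`y = X 0`, `z = X 1`, `A` any commutative ring), let `P` be an
ideal containing `y` and `z`, `𝔮 = P.comap C` its trace on `A`, and `g = yz + C f`. Then

  `(∃ u ∉ P, u·g ∈ P²) ↔ (∃ v ∉ 𝔮, v·f ∈ 𝔮²)`.

* (⇐) take `u = C v`: `C v ∉ P` is the definition of `v ∉ 𝔮`, and
  `C v · g = C v · yz + C (v f)` with `yz ∈ P²` and `C (𝔮²) = (C 𝔮)² ⊆ P²`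
  (`Ideal.map_pow`, `Ideal.map_comap_le`).
* (⇒) apply the constant coefficient `ρ : A[y,z] → A` (`y, z ↦ 0`) and take `v = ρ u`: a polynomial
  lies in `P ⊇ (y, z)` iff `C` of its constant coefficient does (`mem_iff_C_constantCoeff_mem`,
  Theorems/…SuspensionBookkeeping.lean), so `ρ` maps `P` into `𝔮`
  (`map_constantCoeff_le_comap_C`), hence `P²` into `𝔮²`; and `ρ (u g) = ρ u · (0·0 + f) = v f`,
  while `u ∉ P` gives `v ∉ 𝔮` by the same membership criterion.

Only Mathlib's ideal `map`/`comap` API and the tree lemma `mem_iff_C_constantCoeff_mem` are used; no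
facts. (Primality of `P` is part of the registered signature but not needed for the transfer.)
-/

-- single-problem summit: the doubled namespace component is forced
set_option linter.dupNamespace false

namespace Summit.ResolutionOfSingularities.ResolutionOfSingularities.Theorems.FRationalResolution

open MvPolynomial

/-- The constant coefficient `y, z ↦ 0` maps an ideal `P ⊇ (y, z)` of `A[y,z]` into its trace
`P.comap C` on `A`: for `h ∈ P`, `C (h(0)) ∈ P` by `mem_iff_C_constantCoeff_mem`. -/
theorem map_constantCoeff_le_comap_C {A : Type} [CommRing A] {P : Ideal (MvPolynomial (Fin 2) A)}
    (h0 : (X 0 : MvPolynomial (Fin 2) A) ∈ P) (h1 : (X 1 : MvPolynomial (Fin 2) A) ∈ P) :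
    P.map (constantCoeff : MvPolynomial (Fin 2) A →+* A) ≤
      P.comap (C : A →+* MvPolynomial (Fin 2) A) := by
  rw [Ideal.map_le_iff_le_comap]
  intro h hh
  rw [Ideal.mem_comap, Ideal.mem_comap]
  exact (mem_iff_C_constantCoeff_mem h0 h1 h).mp hh

/-- **Transfer of the symbolic-square condition along `y, z ↦ 0`.** In `A[y,z]` (`y = X 0`,
`z = X 1`, any commutative `A`), `P` a prime containing `y, z`, `𝔮 = P ∩ A` (the preimage under `C`),
`g = yz + f`: some `u ∉ P` has `u g ∈ P²` iff some `v ∉ 𝔮` has `v f ∈ 𝔮²`. (⇐: `u = C v`, using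
`C(𝔮²) ⊆ P²` and `yz ∈ P²`; ⇒: `v = u(0,0)`, using that the constant coefficient maps `P` into `𝔮`,
hence `P²` into `𝔮²`, sends `u g` to `u(0,0)·f`, and detects membership in `P ⊇ (y, z)`.) -/
theorem stub_sq_transfer_constantCoeff (A : Type) [CommRing A] (f : A)
    (P : Ideal (MvPolynomial (Fin 2) A)) [P.IsPrime]
    (h0 : (MvPolynomial.X 0 : MvPolynomial (Fin 2) A) ∈ P)
    (h1 : (MvPolynomial.X 1 : MvPolynomial (Fin 2) A) ∈ P) :
    (∃ u : MvPolynomial (Fin 2) A, u ∉ P ∧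
        u * (MvPolynomial.X 0 * MvPolynomial.X 1 + MvPolynomial.C f) ∈ P ^ 2) ↔
      ∃ v : A, v ∉ P.comap (MvPolynomial.C : A →+* MvPolynomial (Fin 2) A) ∧
        v * f ∈ (P.comap (MvPolynomial.C : A →+* MvPolynomial (Fin 2) A)) ^ 2 := by
  constructor
  · rintro ⟨u, huP, hug⟩
    refine ⟨constantCoeff u, ?_, ?_⟩
    · -- `u(0,0) ∈ 𝔮 ↔ C (u(0,0)) ∈ P ↔ u ∈ P`
      intro hv
      rw [Ideal.mem_comap] at hv
      exact huP ((mem_iff_C_constantCoeff_mem h0 h1 u).mpr hv)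
    · -- `y, z ↦ 0` maps `P²` into `𝔮²` and `u g` to `u(0,0)·f`
      have hle : (P ^ 2).map (constantCoeff : MvPolynomial (Fin 2) A →+* A) ≤
          (P.comap (C : A →+* MvPolynomial (Fin 2) A)) ^ 2 := by
        rw [Ideal.map_pow]
        exact Ideal.pow_right_mono (map_constantCoeff_le_comap_C h0 h1) 2
      have himg := hle (Ideal.mem_map_of_mem (constantCoeff : MvPolynomial (Fin 2) A →+* A) hug)
      simpa [constantCoeff_X, constantCoeff_C] using himg
  · rintro ⟨v, hv, hvf⟩
    refine ⟨C v, ?_, ?_⟩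
    · -- `C v ∉ P` is `v ∉ 𝔮` by definition of the preimage
      intro hCv
      exact hv (Ideal.mem_comap.mpr hCv)
    · -- `C v · g = (C v) · yz + C (v f)` with `yz ∈ P²` and `C (𝔮²) ⊆ P²`
      rw [mul_add, ← C_mul]
      refine (P ^ 2).add_mem ?_ ?_
      · rw [pow_two]
        exact Ideal.mul_mem_left _ _ (Ideal.mul_mem_mul h0 h1)
      · have hle : ((P.comap (C : A →+* MvPolynomial (Fin 2) A)) ^ 2).map
            (C : A →+* MvPolynomial (Fin 2) A) ≤ P ^ 2 := by
          rw [Ideal.map_pow]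
          exact Ideal.pow_right_mono Ideal.map_comap_le 2
        exact hle (Ideal.mem_map_of_mem (C : A →+* MvPolynomial (Fin 2) A) hvf)

end Summit.ResolutionOfSingularities.ResolutionOfSingularities.Theorems.FRationalResolution
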